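import Mathlib
import HarnessLib
import Summits.FinalStateConjecture.Statement
import Literature.Geometry.Lorentzian.LandauLifshitzPseudotensor
import Summits.FinalStateConjecture.FinalStateConjecture.Theorems.EIHFluxBalanceInertialRecessionStubRechartUntwist
import Summits.FinalStateConjecture.FinalStateConjecture.Theorems.EIHFluxBalanceInertialRecessionStubQuasiStationarityStabiliser
import Summits.FinalStateConjecture.FinalStateConjecture.Theorems.EIHFluxBalanceInertialRecessionLabVelocity
import Summits.FinalStateConjecture.FinalStateConjecture.Theorems.EIHFluxBalanceInertialRecessionBoostCalculus
import Summits.FinalStateConjecture.FinalStateConjecture.Theorems.EIHFluxBalanceInertialRecessionLorentz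
import Literature.Geometry.Lorentzian.LorentzBoost

/-!
# Route EIHFluxBalance — `InertialRecession`, re-charting: normalised painted frames

Helper file for the crux `stmt-FinalStateConjecture-10166`
(`Summit.FinalStateConjecture.FinalStateConjecture.Theses.EIHFluxBalance.InertialRecession`),
line `sublinear-is-free-clean-window-charges`, stub `stub_rechart` (the transfer P2), part G1.

Third-order slaving controls only the columns `Λᵢe₀` (and `Λᵢe₃` when `aᵢ ≠ 0`) of a painted frame,
never `deriv Λᵢ` itself (`Negative/PaintingRigidityStabiliser`). The hole charts of the transfer are
built from a **normalised frame** `Λ̃ᵢ : ℝ → lorentzGroup` which paints the SAME background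
(`boostedKerrBilin (Λᵢ t) c = boostedKerrBilin (Λ̃ᵢ t) c`, same painted Kerr–Schild radii), has the
same 4-velocity column `Λ̃ᵢe₀ = Λᵢe₀`, and ALL of whose derivatives of orders `1, 2, 3` tend to `0`:
for `aᵢ ≠ 0` the untwisted frame `Λᵢ·R_{θ(t)}` of `…StubRechartUntwist`; for `aᵢ = 0` the pure
boost `boost(vᵢ(t))` of the painted lab velocity (Schwarzschild isotropy,
`…StubQuasiStationarityStabiliser.kerrBilin_zero_spin_invariant`), which needs the frame to be
future-oriented, `(Λᵢe₀)⁰ > 0`.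

* `tendsto_iteratedDeriv_comp_of_isCompact` — Faà di Bruno decay: derivatives of `g ∘ w` tend to
  `0` when those of `w` do, `w` ranging in a compact set on a neighbourhood of which `g` is smooth;
* `tendsto_iteratedDeriv_labVelocity` — decay of the derivatives of the painted lab velocity;
* `exists_normalisedFrame'` (registered one-line form `rechart_exists_normalisedFrame`).
-/

noncomputable section

set_option linter.dupNamespace false

open Set Filter Function Metric Topology
open scoped ContDiff
open Literature.Geometry.Lorentzian
open Summit.FinalStateConjecture.FinalStateConjecture.Theorems.InertialRecession.Negative

namespace Summit.FinalStateConjecture.FinalStateConjecture.Theorems.SublinearIsFree.Rechart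

/-! ### Faà di Bruno decay through a smooth map -/

/-- **Faà di Bruno decay.** Let `g` be smooth on an open set `O` containing the compact set `K`,
and `w : ℝ → F'` a `C³` path with values in `K` whose derivatives of orders `1, 2, 3` tend to `0`
at `+∞`. Then the derivatives of orders `1, 2, 3` of `g ∘ w` tend to `0`. [folklore] -/
theorem tendsto_iteratedDeriv_comp_of_isCompact {F' F : Type*} [NormedAddCommGroup F']
    [NormedSpace ℝ F'] [NormedAddCommGroup F] [NormedSpace ℝ F] {g : F' → F} {O K : Set F'}
    (hO : IsOpen O) (hK : IsCompact K) (hKO : K ⊆ O) (hg : ContDiffOn ℝ ∞ g O) {w : ℝ → F'}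
    (hw : ContDiff ℝ 3 w) (hwK : ∀ t, w t ∈ K)
    (hdec : ∀ j, 1 ≤ j → j ≤ 3 → Tendsto (fun t ↦ iteratedDeriv j w t) atTop (𝓝 0)) :
    ∀ l, 1 ≤ l → l ≤ 3 → Tendsto (fun t ↦ iteratedDeriv l (fun s ↦ g (w s)) t) atTop (𝓝 0) := by
  -- uniform bounds for the derivatives of `g` on `K`
  have hbound : ∀ i : ℕ, ∃ C : ℝ, ∀ u ∈ K, ‖iteratedFDeriv ℝ i g u‖ ≤ C := by
    intro i
    have h1 := hg.continuousOn_iteratedFDerivWithin (m := i) (by exact_mod_cast le_top)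
      hO.uniqueDiffOn
    have h2 := h1.congr (g := iteratedFDeriv ℝ i g)
      fun p hp ↦ (iteratedFDerivWithin_of_isOpen i hO hp).symm
    obtain ⟨C, hC⟩ := hK.exists_bound_of_continuousOn (h2.mono hKO)
    exact ⟨C, hC⟩
  choose C hC using hbound
  set Cmax : ℝ := ∑ i ∈ Finset.range 4, |C i| with hCmax
  have hCmax0 : 0 ≤ Cmax := Finset.sum_nonneg fun _ _ ↦ abs_nonneg _
  have hCi : ∀ i ≤ 3, ∀ u ∈ K, ‖iteratedFDeriv ℝ i g u‖ ≤ Cmax :=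
    fun i hi u hu ↦ ((hC i u hu).trans (le_abs_self _)).trans
      (Finset.single_le_sum (f := fun i ↦ |C i|) (fun _ _ ↦ abs_nonneg _)
        (Finset.mem_range.mpr (by omega)))
  -- the pointwise Faà di Bruno bound
  have hkey : ∀ (t d : ℝ), 0 ≤ d → d ≤ 1 → (∀ j, 1 ≤ j → j ≤ 3 → ‖iteratedDeriv j w t‖ ≤ d ^ j) →
      ∀ l, 1 ≤ l → l ≤ 3 → ‖iteratedDeriv l (fun s ↦ g (w s)) t‖ ≤ 6 * Cmax * d := by
    intro t d hd0 hd1 hwb l hl1 hl3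
    have hwt : w t ∈ K := hwK t
    set s : Set ℝ := w ⁻¹' O with hs
    have hso : IsOpen s := hO.preimage hw.continuous
    have hts : t ∈ s := hKO hwt
    have hcomp := norm_iteratedFDerivWithin_comp_le (g := g) (f := w) (n := l)
      (N := ((3 : ℕ∞) : WithTop ℕ∞)) (x := t) (hg.of_le (by exact_mod_cast le_top)) hw.contDiffOn
      (by exact_mod_cast hl3) hO.uniqueDiffOn hso.uniqueDiffOn (fun y hy ↦ hy) hts (C := Cmax) (D := d)
      (fun i hi ↦ by
        rw [iteratedFDerivWithin_of_isOpen i hO (hKO hwt)]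
        exact hCi i (hi.trans hl3) (w t) hwt)
      (fun i hi1 hij ↦ by
        rw [iteratedFDerivWithin_of_isOpen i hso hts, norm_iteratedFDeriv_eq_norm_iteratedDeriv]
        exact hwb i hi1 (hij.trans hl3))
    rw [iteratedFDerivWithin_of_isOpen l hso hts] at hcomp
    rw [← norm_iteratedFDeriv_eq_norm_iteratedDeriv]
    refine hcomp.trans ?_
    have h1 : (l.factorial : ℝ) ≤ 6 := by
      interval_cases l <;> norm_num [Nat.factorial]
    have h2 : d ^ l ≤ d := by
      obtain ⟨k, rfl⟩ := Nat.exists_eq_add_of_le' hl1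
      rw [pow_succ]
      exact mul_le_of_le_one_left hd0 (pow_le_one₀ hd0 hd1)
    calc (l.factorial : ℝ) * Cmax * d ^ l ≤ 6 * Cmax * d :=
          mul_le_mul (mul_le_mul_of_nonneg_right h1 hCmax0) h2 (pow_nonneg hd0 l) (by positivity)
      _ = 6 * Cmax * d := rfl
  -- conclusion
  intro l hl1 hl3
  rw [Metric.tendsto_nhds]
  intro ε hε
  -- choose `d` with `6 Cmax d < ε`
  obtain ⟨d, hd0, hd1, hdε⟩ : ∃ d : ℝ, 0 < d ∧ d ≤ 1 ∧ 6 * Cmax * d < ε := by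
    refine ⟨min 1 (ε / (6 * Cmax + 1) / 2), by positivity, min_le_left _ _, ?_⟩
    have h1 : 6 * Cmax * min 1 (ε / (6 * Cmax + 1) / 2) ≤ 6 * Cmax * (ε / (6 * Cmax + 1) / 2) :=
      mul_le_mul_of_nonneg_left (min_le_right _ _) (by positivity)
    have h2 : 6 * Cmax * (ε / (6 * Cmax + 1) / 2) < ε := by
      rw [show 6 * Cmax * (ε / (6 * Cmax + 1) / 2) = ε * (6 * Cmax / (6 * Cmax + 1)) / 2 by ring]
      have : 6 * Cmax / (6 * Cmax + 1) < 1 := by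
        rw [div_lt_one (by positivity)]; linarith
      nlinarith
    linarith
  -- eventually all derivatives of `w` are below `d ^ j`
  have hev : ∀ᶠ t in atTop, ∀ j, 1 ≤ j → j ≤ 3 → ‖iteratedDeriv j w t‖ ≤ d ^ j := by
    have h : ∀ j ∈ Finset.Icc 1 3, ∀ᶠ t in atTop, ‖iteratedDeriv j w t‖ ≤ d ^ j := by
      intro j hj
      rw [Finset.mem_Icc] at hj
      have := (hdec j hj.1 hj.2).norm
      rw [norm_zero] at this
      exact (this.eventually (ge_mem_nhds (pow_pos hd0 j))).mono fun t ht ↦ ht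
    filter_upwards [(Finset.eventually_all (Finset.Icc 1 3)).mpr h] with t ht
    exact fun j hj1 hj3 ↦ ht j (Finset.mem_Icc.mpr ⟨hj1, hj3⟩)
  filter_upwards [hev] with t ht
  rw [dist_zero_right]
  exact (hkey t d hd0.le hd1 ht l hl1 hl3).trans_lt hdε

/-! ### Decay of the derivatives of the painted lab velocity -/

/-- **The painted lab velocity has decaying derivatives.** For a smooth 4-velocity path
`u : ℝ → E4` with `1 ≤ u⁰ ≤ γ` and `(u⁰)² = 1 + |ũ|²`, whose derivatives of orders `1, 2, 3` tend
to `0`, the lab velocity `v = ũ/u⁰` has derivatives of orders `1, 2, 3` tending to `0` (Faà di Bruno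
through the smooth map `u ↦ ũ/u⁰` on the compact set `{1 ≤ u⁰, ‖u‖ ≤ 2γ}`). [folklore] -/
theorem tendsto_iteratedDeriv_labVelocity {u : ℝ → E4} {γ : ℝ} (hu : ContDiff ℝ ∞ u)
    (h1 : ∀ t, 1 ≤ u t 0) (hγ : ∀ t, u t 0 ≤ γ) (hnorm : ∀ t, ‖u t‖ ≤ 2 * γ)
    (hdec : ∀ j, 1 ≤ j → j ≤ 3 → Tendsto (fun t ↦ iteratedDeriv j u t) atTop (𝓝 0)) :
    ∀ l, 1 ≤ l → l ≤ 3 →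
      Tendsto (fun t ↦ iteratedDeriv l (fun s ↦ ((u s) 0)⁻¹ • E4.spatial (u s)) t) atTop (𝓝 0) := by
  have hc0 : Continuous fun w : E4 ↦ w 0 := (EuclideanSpace.proj (0 : Fin 4) : E4 →L[ℝ] ℝ).continuous
  set O : Set E4 := {w | 1 / 2 < w 0} with hO
  set K : Set E4 := {w | 1 ≤ w 0} ∩ closedBall 0 (2 * γ) with hK
  have hOo : IsOpen O := isOpen_lt continuous_const hc0
  have hKc : IsCompact K :=
    (isCompact_closedBall (0 : E4) (2 * γ)).inter_left (isClosed_le continuous_const hc0)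
  have hKO : K ⊆ O := fun w hw ↦ by
    have : 1 ≤ w 0 := hw.1
    show 1 / 2 < w 0
    linarith
  have hg : ContDiffOn ℝ ∞ (fun w : E4 ↦ (w 0)⁻¹ • E4.spatial w) O := fun w hw ↦
    (contDiffAt_labVelocityMap (by have : 1 / 2 < w 0 := hw; positivity)).contDiffWithinAt
  have hwK : ∀ t, u t ∈ K := fun t ↦ ⟨h1 t, by simpa using hnorm t⟩
  have _ := hγ
  exact tendsto_iteratedDeriv_comp_of_isCompact hOo hKc hKO hg
    (hu.of_le (WithTop.coe_le_coe.mpr le_top)) hwK hdec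

/-- **The pure-boost frame of a decaying velocity has decaying derivatives**: if `v : ℝ → E3` is
smooth with `‖v‖ ≤ κ₀ < 1` and derivatives of orders `1, 2, 3` tending to `0`, then so does
`t ↦ boost(v(t))` (as an operator path). [folklore] -/
theorem tendsto_iteratedDeriv_boostCLM_comp {v : ℝ → E3} {κ₀ : ℝ} (hκ₀ : κ₀ < 1)
    (hv : ContDiff ℝ ∞ v) (hvs : ∀ t, ‖v t‖ ≤ κ₀)
    (hdec : ∀ j, 1 ≤ j → j ≤ 3 → Tendsto (fun t ↦ iteratedDeriv j v t) atTop (𝓝 0)) :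
    ∀ l, 1 ≤ l → l ≤ 3 →
      Tendsto (fun t ↦ iteratedDeriv l (fun s ↦ Lorentz.boostCLM (v s)) t) atTop (𝓝 0) :=
  tendsto_iteratedDeriv_comp_of_isCompact isOpen_ball (isCompact_closedBall (0 : E3) κ₀)
    (closedBall_subset_ball hκ₀) contDiffOn_boostCLM (hv.of_le (WithTop.coe_le_coe.mpr le_top))
    (fun t ↦ by simpa using hvs t) hdec

/-! ### The normalised frame -/

/-- The pure boost as an operator is `boostCLM`. [folklore] -/
theorem coe_coe_boost {v : E3} (hv : ‖v‖ < 1) :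
    (((Lorentz.boost v hv : lorentzGroup) : E4 ≃L[ℝ] E4) : E4 →L[ℝ] E4) = Lorentz.boostCLM v :=
  ContinuousLinearMap.ext fun _ ↦ rfl

/-- **The 4-velocity of a future-oriented Lorentz frame is the 4-velocity of the boost by its
lab velocity**: if `u = Λe₀` has `u⁰ > 0` and `v = ũ/u⁰` then `boost(v) e₀ = u`. [folklore] -/
theorem boost_labVelocity_apply_basisVector_zero (Λ : lorentzGroup)
    (h0 : 0 < ((Λ : E4 ≃L[ℝ] E4) (E4.basisVector 0)) 0)
    (hv : ‖((((Λ : E4 ≃L[ℝ] E4) (E4.basisVector 0)) 0)⁻¹ •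
      E4.spatial ((Λ : E4 ≃L[ℝ] E4) (E4.basisVector 0)))‖ < 1) :
    ((Lorentz.boost _ hv : lorentzGroup) : E4 ≃L[ℝ] E4) (E4.basisVector 0) =
      (Λ : E4 ≃L[ℝ] E4) (E4.basisVector 0) := by
  set u : E4 := (Λ : E4 ≃L[ℝ] E4) (E4.basisVector 0) with hu
  set w : E3 := ((u 0)⁻¹ • E4.spatial u) with hw
  have hsq := lorentz_apply_zero_sq Λ
  rw [← hu] at hsq
  -- `γ(w) = u⁰`
  have hγ : Lorentz.gamma w = u 0 := by
    have hws : ‖w‖ ^ 2 = 1 - ((u 0) ^ 2)⁻¹ := by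
      rw [hw, norm_smul, norm_inv, Real.norm_of_nonneg h0.le, mul_pow, inv_pow]
      have : ‖E4.spatial u‖ = E4.spatialNorm u := rfl
      rw [this]
      field_simp
      linarith
    unfold Lorentz.gamma
    rw [hws, show (1 : ℝ) - (1 - ((u 0) ^ 2)⁻¹) = ((u 0)⁻¹) ^ 2 by ring, Real.sqrt_sq (by positivity),
      inv_inv]
  rw [Lorentz.boost_apply_basisVector_zero, hγ]
  have h1 : (u 0) • w = E4.spatial u := by
    rw [hw, smul_smul, mul_inv_cancel₀ h0.ne', one_smul]
  rw [h1]
  exact E4.ofTimeSpace_time_spatial u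

/-- **Normalised painted frame.** Let `Λ : ℝ → lorentzGroup` be a smooth painted frame with
future-oriented, bounded Lorentz factor `0 < (Λe₀)⁰ ≤ γ`, whose 4-velocity column has derivatives
of orders `1, 2, 3` tending to `0`, and — when the spin `a` is nonzero — whose axis column `Λe₃`
does too. Then there is a smooth frame `Λ̃` with the same 4-velocity column, ALL of whose
derivatives of orders `1, 2, 3` tend to `0`, painting the same boosted Kerr–Schild field and the
same Kerr–Schild radii for the parameters `(M, a)`. [folklore] -/
theorem exists_normalisedFrame' (Λ : ℝ → lorentzGroup) (γ M a : ℝ)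
    (hΛ : ContDiff ℝ ∞ (fun t ↦ ((Λ t : E4 ≃L[ℝ] E4) : E4 →L[ℝ] E4)))
    (hγ : ∀ t, |((Λ t : E4 ≃L[ℝ] E4) (E4.basisVector 0)) 0| ≤ γ)
    (hpos : ∀ t, 0 < ((Λ t : E4 ≃L[ℝ] E4) (E4.basisVector 0)) 0)
    (hu : ∀ m, 1 ≤ m → m ≤ 3 → Tendsto (fun t ↦ iteratedDeriv m
      (fun s ↦ (Λ s : E4 ≃L[ℝ] E4) (E4.basisVector 0)) t) atTop (𝓝 0))
    (hs : a ≠ 0 → ∀ m, 1 ≤ m → m ≤ 3 → Tendsto (fun t ↦ iteratedDeriv m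
      (fun s ↦ (Λ s : E4 ≃L[ℝ] E4) (E4.basisVector 3)) t) atTop (𝓝 0)) :
    ∃ Λ' : ℝ → lorentzGroup, ContDiff ℝ ∞ (fun t ↦ ((Λ' t : E4 ≃L[ℝ] E4) : E4 →L[ℝ] E4)) ∧
      (∀ t, (Λ' t : E4 ≃L[ℝ] E4) (E4.basisVector 0) = (Λ t : E4 ≃L[ℝ] E4) (E4.basisVector 0)) ∧
      (∀ m, 1 ≤ m → m ≤ 3 → Tendsto (fun t ↦ iteratedDeriv m
        (fun s ↦ ((Λ' s : E4 ≃L[ℝ] E4) : E4 →L[ℝ] E4)) t) atTop (𝓝 0)) ∧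
      (∀ t c x, boostedKerrBilin (Λ t) c M a x = boostedKerrBilin (Λ' t) c M a x) ∧
      (∀ t c x, Kerr.radius a (poincareInv (Λ t) c x) = Kerr.radius a (poincareInv (Λ' t) c x)) := by
  by_cases ha : a = 0
  · -- spin zero: the pure boost by the painted lab velocity
    subst ha
    set u : ℝ → E4 := fun t ↦ (Λ t : E4 ≃L[ℝ] E4) (E4.basisVector 0) with hudef
    set v : ℝ → E3 := fun t ↦ ((u t) 0)⁻¹ • E4.spatial (u t) with hvdef
    have hu0 : ∀ t, 0 < u t 0 := hpos
    have huγ : ∀ t, u t 0 ≤ γ := fun t ↦ (le_abs_self _).trans (hγ t)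
    have hγ1 : ∀ t, 1 ≤ u t 0 := fun t ↦ by
      have := one_le_abs_lorentz_apply_zero (Λ t)
      rwa [abs_of_pos (hpos t)] at this
    obtain ⟨hvle, hκ⟩ : (∀ t, ‖v t‖ ≤ Real.sqrt (1 - (γ ^ 2)⁻¹)) ∧ Real.sqrt (1 - (γ ^ 2)⁻¹) < 1 :=
      ⟨fun t ↦ (norm_labVelocity_le_sqrt (Λ t) (hpos t) (huγ t)).1,
        (norm_labVelocity_le_sqrt (Λ 0) (hpos 0) (huγ 0)).2⟩
    have hv1 : ∀ t, ‖v t‖ < 1 := fun t ↦ (hvle t).trans_lt hκ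
    have hus : ContDiff ℝ ∞ u := hΛ.clm_apply contDiff_const
    have hvs : ContDiff ℝ ∞ v := contDiff_labVelocity hus fun t ↦ (hu0 t).ne'
    -- the frame
    refine ⟨fun t ↦ Lorentz.boost (v t) (hv1 t), ?_, ?_, ?_, ?_, ?_⟩
    · simp only [coe_coe_boost]
      exact contDiff_iff_contDiffAt.mpr fun t ↦
        ((contDiffOn_boostCLM (v t) (by simpa using hv1 t)).contDiffAt
          (isOpen_ball.mem_nhds (by simpa using hv1 t))).comp t hvs.contDiffAt
    · exact fun t ↦ boost_labVelocity_apply_basisVector_zero (Λ t) (hpos t) (hv1 t)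
    · -- decay of all derivatives
      have hnorm : ∀ t, ‖u t‖ ≤ 2 * γ := fun t ↦ by
        have h := norm_sq_eq_sq_add_spatialNorm_sq (u t)
        have hsq := lorentz_apply_zero_sq (Λ t)
        have hγ0 : 0 ≤ γ := (hu0 t).le.trans (huγ t)
        have h2 : ‖u t‖ ^ 2 ≤ (2 * γ) ^ 2 := by
          rw [h]
          have : E4.spatialNorm (u t) ^ 2 = (u t 0) ^ 2 - 1 := by rw [hudef]; linarith
          nlinarith [pow_le_pow_left₀ (hu0 t).le (huγ t) 2]
        exact le_of_pow_le_pow_left₀ two_ne_zero (by positivity) h2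
      have hvdec := tendsto_iteratedDeriv_labVelocity hus hγ1 huγ hnorm hu
      simp only [coe_coe_boost]
      exact tendsto_iteratedDeriv_boostCLM_comp hκ hvs hvle hvdec
    · -- the same painted field (Schwarzschild isotropy)
      intro t c x
      set B : lorentzGroup := Lorentz.boost (v t) (hv1 t) with hB
      set R : E4 → E4 := fun z ↦ (B : E4 ≃L[ℝ] E4).symm ((Λ t : E4 ≃L[ℝ] E4) z) with hR
      have hRi : ∀ p q, Minkowski.bilin (R p) (R q) = Minkowski.bilin p q := fun p q ↦ by
        have h1 := B.2 ((B : E4 ≃L[ℝ] E4).symm ((Λ t : E4 ≃L[ℝ] E4) p))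
          ((B : E4 ≃L[ℝ] E4).symm ((Λ t : E4 ≃L[ℝ] E4) q))
        rw [ContinuousLinearEquiv.apply_symm_apply, ContinuousLinearEquiv.apply_symm_apply] at h1
        rw [hR, ← h1]
        exact (Λ t).2 p q
      have hR0 : R (E4.basisVector 0) = E4.basisVector 0 := by
        have hBu : (B : E4 ≃L[ℝ] E4) (E4.basisVector 0) = u t :=
          boost_labVelocity_apply_basisVector_zero (Λ t) (hpos t) (hv1 t)
        rw [hR]
        show (B : E4 ≃L[ℝ] E4).symm (u t) = E4.basisVector 0
        rw [← hBu, ContinuousLinearEquiv.symm_apply_apply]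
      have hRs : ∀ z, R ((Λ t : E4 ≃L[ℝ] E4).symm z) = (B : E4 ≃L[ℝ] E4).symm z := fun z ↦ by
        rw [hR]
        simp only [ContinuousLinearEquiv.apply_symm_apply]
      ext p q
      rw [boostedKerrBilin_apply, boostedKerrBilin_apply, poincareInv, poincareInv, ← hRs, ← hRs,
        ← hRs, QuasiStationarity.kerrBilin_zero_spin_invariant hRi hR0]
    · -- the same painted radius
      intro t c x
      set B : lorentzGroup := Lorentz.boost (v t) (hv1 t) with hB
      set R : E4 → E4 := fun z ↦ (B : E4 ≃L[ℝ] E4).symm ((Λ t : E4 ≃L[ℝ] E4) z) with hR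
      have hRi : ∀ p q, Minkowski.bilin (R p) (R q) = Minkowski.bilin p q := fun p q ↦ by
        have h1 := B.2 ((B : E4 ≃L[ℝ] E4).symm ((Λ t : E4 ≃L[ℝ] E4) p))
          ((B : E4 ≃L[ℝ] E4).symm ((Λ t : E4 ≃L[ℝ] E4) q))
        rw [ContinuousLinearEquiv.apply_symm_apply, ContinuousLinearEquiv.apply_symm_apply] at h1
        rw [hR, ← h1]
        exact (Λ t).2 p q
      have hR0 : R (E4.basisVector 0) = E4.basisVector 0 := by
        have hBu : (B : E4 ≃L[ℝ] E4) (E4.basisVector 0) = u t :=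
          boost_labVelocity_apply_basisVector_zero (Λ t) (hpos t) (hv1 t)
        rw [hR]
        show (B : E4 ≃L[ℝ] E4).symm (u t) = E4.basisVector 0
        rw [← hBu, ContinuousLinearEquiv.symm_apply_apply]
      have hRs : ∀ z, R ((Λ t : E4 ≃L[ℝ] E4).symm z) = (B : E4 ≃L[ℝ] E4).symm z := fun z ↦ by
        rw [hR]
        simp only [ContinuousLinearEquiv.apply_symm_apply]
      rw [poincareInv, poincareInv, ← hRs, Kerr.radius_zero_left, Kerr.radius_zero_left,
        QuasiStationarity.spatialNorm_of_isometry_fix hRi hR0]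
  · -- spin nonzero: untwist
    obtain ⟨θ, -, hFs, hFd⟩ := exists_untwisted_frame' Λ γ 3 hΛ hγ hu (hs ha)
    refine ⟨fun t ↦ Λ t * rotL (θ t), hFs, fun t ↦ ?_, hFd, fun t c x ↦ ?_, fun t c x ↦ ?_⟩
    · rw [mul_rotL_apply, rotCLM_basisVector_zero]
    · rw [boostedKerrBilin_mul_rotL]
    · rw [radius_poincareInv_mul_rotL]

/-- Registered one-line form (worker carrier `rechart_exists_normalisedFrame`) of
`exists_normalisedFrame'`. [folklore] -/
theorem rechart_exists_normalisedFrame : open Literature.Geometry.Lorentzian Filter Topology in ∀ (Λ : ℝ → lorentzGroup) (γ M a : ℝ), ContDiff ℝ ((⊤ : ℕ∞) : WithTop ℕ∞) (fun t ↦ ((Λ t : E4 ≃L[ℝ] E4) : E4 →L[ℝ] E4)) → (∀ t, |((Λ t : E4 ≃L[ℝ] E4) (E4.basisVector 0)) 0| ≤ γ) → (∀ t, 0 < ((Λ t : E4 ≃L[ℝ] E4) (E4.basisVector 0)) 0) → (∀ m : ℕ, 1 ≤ m → m ≤ 3 → Tendsto (fun t ↦ iteratedDeriv m (fun s ↦ (((Λ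 s : lorentzGroup) : E4 ≃L[ℝ] E4) (E4.basisVector 0))) t) atTop (𝓝 0)) → (a ≠ 0 → ∀ m : ℕ, 1 ≤ m → m ≤ 3 → Tendsto (fun t ↦ iteratedDeriv m (fun s ↦ (((Λ s : lorentzGroup) : E4 ≃L[ℝ] E4) (E4.basisVector 3))) t) atTop (𝓝 0)) → ∃ Λ' : ℝ → lorentzGroup, ContDiff ℝ ((⊤ : ℕ∞) : WithTop ℕ∞) (fun t ↦ ((Λ' t : E4 ≃L[ℝ] E4) : E4 →L[ℝ] E4)) ∧ (∀ t, (Λ' t : E4 ≃L[ℝ] E4) (E4.basisVector 0) = (Λ t : E4 ≃L[ℝ] E4) (E4.basisVector 0)) ∧ (∀ m : ℕ, 1 ≤ m → m ≤ 3 → Tendsto (fun t ↦ iteratedDeriv m (fun s ↦ (((Λ' s : lorentzGroup) : E4 ≃L[ℝ] E4) : E4 →L[ℝ] E4)) t) atTop (𝓝 0)) ∧ (∀ (t : ℝ) (c x : E4), boostedKerrBilin (Λ t) c M a x = boostedKerrBilin (Λ' t) c M a x) ∧ (∀ (t : ℝ) (c x : E4), Kerr.radius a (poincareInv (Λ t)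 c x) = Kerr.radius a (poincareInv (Λ' t) c x)) :=
  fun Λ γ M a hΛ hγ hpos hu hs ↦ exists_normalisedFrame' Λ γ M a hΛ hγ hpos hu hs

end Summit.FinalStateConjecture.FinalStateConjecture.Theorems.SublinearIsFree.Rechart

end
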